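import Mathlib
import HarnessLib
import HarnessLib.Audit
import Summits.Langlands.Statement
import HarnessLib.Audit.Status.Attr

/-!
Route: E8QuinticResidue

# Route E8QuinticResidue — E8(a7) Eisenstein residue over Bhargava's quintic grading names the A5
field of an icosahedral Maass pair

A BOOKER PAIR is a pair of cuspidal automorphic representations π, π' of GL₂(𝔸_ℚ), not nearly
equivalent, neither of dihedral type
(no quadratic self-twist at the Satake level: for no quadratic field K are the Satake parameters at
almost every K-inert place
stable under α ↦ −α; Booker2018 Thm 1 'not of dihedral Galois type'), with trivial central character
and Hecke eigenvalues λ_π(p) = a + bφ, λ_π'(p) = a + bφ^τ ∈ ℤ[φ]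
(φ = (1+√5)/2) at almost every p (Booker2018 Thm 1: weight-0 Maass, λ_π(p) ∈ A = {0,±1,±2,±φ,±φ^τ}
off a thin set S, all Sym^k
weakly automorphic, "unable to conclude the existence of an associated Galois representation").
Thesis X (it suffices to show; decl
`BookerPairReciprocity`, the Target, Lean line below): every Booker pair has an irreducible σ : Γ_ℚ
→ GL₂(ℂ) of icosahedral type with
π = π(σ). The route reaches X through X2 ∧ X4 ∧ X3 (assembly = pure logic):
X2 `QuinticFieldOfPair` — every Booker pair has a QUINTIC FIELD K/ℚ whose splitting type at almost
every p is the mock-Frobenius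
type of λ_π(p) ((1⁵),(2²1),(31²),(5) for λ = ±2, 0, ±1, ±φ^{(τ)}) — the arithmetic output of the
card's E₈(a₇) chain K3→K2→K1
(residue of the E₈ Eisenstein series induced from (π⊠π^τ)⊗Sym⁴π on the Levi GL₄×SL₅ of P_{α₅}, whose
abelianised unipotent radical
is Bhargava's quintic space 4⊗∧²5, read through the rational orbit carrying a non-zero Fourier
coefficient); X4 `NoExceptionalPrimes`
— Booker pairs are tempered at almost every p (S finite, hence empty); X3 `NoChimeras` — given both,
π = π(σ) for an irreducible σ of
icosahedral type. X is direction (A) of the summit for n = 2, F = ℚ in Booker's class (the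
non-solvable EVEN sector, where no
instance is known), in the Artin form π = π(σ) (Satake–Frobenius matching at almost every place: the
definiens of `IsPiOfArtinRep`, the form used by
every strong-Artin route of this summit); the deciding theorem
`closes : QuinticFieldOfPair → NoChimeras → NoExceptionalPrimes → SectorComplement → Langlands`
(D-0027 §2.1, native verdict ok)
carries X to the sub-problem Statement through the declared, NOT-claimed out-of-scope remainder
`SectorComplement :
BookerPairReciprocity → Langlands` (support, rank 9: the rest of GL_n reciprocity; never staffed
from this route). Card realised: e8a7-quintic-fourier-support (spine, sole card).
Lean: `∀ (hcpt : Literature.NumberTheory.Automorphic.isCompact_glFiniteIntegralLevel 2 ℚ) (π π' :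
Literature.NumberTheory.Automorphic.CuspidalAutomorphicRepData 2 ℚ hcpt), ¬ π.1.IsNearlyEquivalent
π'.1 → (∀ (K : Type) [Field K] [NumberField K], Module.finrank ℚ K = 2 → ¬ ∀ᶠ v :
IsDedekindDomain.HeightOneSpectrum (NumberField.RingOfIntegers ℚ) in Filter.cofinite, (Ideal.span
{((v.residueCard : ℕ) : NumberField.RingOfIntegers K)}).IsPrime → ∀ α : Multiset ℂ,
π.1.HasSatakeParamAt v α → π.1.HasSatakeParamAt v (α.map fun a => -a)) → (∀ (K : Type) [Field K]
[NumberField K], Module.finrank ℚ K = 2 → ¬ ∀ᶠ v : IsDedekindDomain.HeightOneSpectrum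
(NumberField.RingOfIntegers ℚ) in Filter.cofinite, (Ideal.span {((v.residueCard : ℕ) :
NumberField.RingOfIntegers K)}).IsPrime → ∀ α : Multiset ℂ, π'.1.HasSatakeParamAt v α →
π'.1.HasSatakeParamAt v (α.map fun a => -a)) → (∀ᶠ v : IsDedekindDomain.HeightOneSpectrum
(NumberField.RingOfIntegers ℚ) in Filter.cofinite, ∃ α α' : Multiset ℂ, π.1.HasSatakeParamAt v α ∧
π'.1.HasSatakeParamAt v α' ∧ α.prod = 1 ∧ α'.prod = 1 ∧ ∃ a b : ℤ, α.sum = (a : ℂ) + (b : ℂ) * ((1 +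
(Real.sqrt 5 : ℂ)) / 2) ∧ α'.sum = (a : ℂ) + (b : ℂ) * ((1 - (Real.sqrt 5 : ℂ)) / 2)) → ∃ σ :
Literature.NumberTheory.GaloisRepresentations.FramedGaloisRep ℚ ℂ 2, σ.toGaloisRep.IsIrreducible ∧
Nonempty ((Matrix.ProjGenLinGroup.mk.comp σ.toMonoidHom).range ≃* alternatingGroup (Fin 5)) ∧ ∀ᶠ v :
IsDedekindDomain.HeightOneSpectrum (NumberField.RingOfIntegers ℚ) in Filter.cofinite, ∃ α : Multiset
ℂ, π.1.HasSatakeParamAt v α ∧ σ.IsUnramifiedAt v ∧ σ.HasFrobCharpolyAt v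
(Literature.NumberTheory.Automorphic.satakePolynomial α)`

TYPING (cone route-repair 2026-08-15, unit rrepair-Langlands-E8QuinticResidue-f80e030d). Every item
is typed over the cone of
`Summits.Langlands.Statement` ALONE (route imports: none beyond the Statement's own; the former
imports
Automorphic.StrongArtinGL2 and Automorphic.RamakrishnanTensorProductGL2 carried 21 unproved named
facts — strongArtin_of_isSolvable /
_isDihedralType / _isTetrahedralType / _isOctahedralType, exists_isNewform1_of_isPiOfArtinRep,
frobSatakeCompatibleAt_of_isPiOfArtinRep,
Ramakrishnan2000_theoremM, Ramakrishnan2000_multiplicityOneSL2,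
DeligneSerre1974.thm46a_artinConductorNat_eq, exists_isNewformOf,
existsUnique_isNewformOf, exists_complexGaloisRep_of_weight_one,
exists_weierstrassCurve_of_rational_isNewform0,
exists_padicGaloisRep_of_isNewform1, heckeLFunction_functional_equation /
_hasEntireContinuation_of_not_isNormTwist /
_hasMeromorphicContinuation, GaloisRep.natCast_localArtinConductor,
(NumberField.)ExtendedRiemannHypothesis(') — that were hypotheses
of NO item and are gone from the cone; needs-fact: none; what remains in the cone enters through
`import Summits.Langlands.Statement`
itself and is common to every route of the summit). Dictionary (definitional, checked rc 0 in the
unit's Sketch.lean/Equiv.lean):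
`FramedArtinRep ℚ 2` = `GaloisRepresentations.FramedGaloisRep ℚ ℂ 2`; `IsIcosahedralType
σ.toMonoidHom` =
`Nonempty ((Matrix.ProjGenLinGroup.mk.comp σ.toMonoidHom).range ≃* alternatingGroup (Fin 5))`;
`IsPiOfArtinRep σ π.1` =
`∀ᶠ v in cofinite, ∃ α, π.1.HasSatakeParamAt v α ∧ σ.IsUnramifiedAt v ∧ σ.HasFrobCharpolyAt v
(satakePolynomial α)`. ONE hypothesis
changes wording, not class: `¬ IsSatakeSelfTwist π.1` (no self-twist by any idele class character δ
≠ 1, which needs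
GaloisRepresentations.HeckeCharacter and its 3 unproved XL facts) becomes the field-theoretic 'π is
not of dihedral type': for every
quadratic number field K it is false that at almost every place v inert in K (p𝓞_K prime, p = N v)
every Satake parameter α of π at v
satisfies `π.HasSatakeParamAt v (α.map (−·))` — i.e. no Satake self-twist by χ_K (χ_K(ϖ_v) = −1 at
inert, +1 at split v); for
cuspidal π on GL₂/ℚ with trivial central character a.e. every Satake self-twist character has δ(ϖ_v)
= ±1 a.e., hence is some χ_K,
so the Booker class is unchanged (Booker2018 Thm 1 hypothesis 'not of dihedral Galois type';
Ramakrishnan2000 Prop. 2.3.1(2)).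

## Assembly
Pure logic, CHECKED (deciding theorem `closes`, installed with `route edit --closes-file`, three
lines: given a Booker pair apply
NoChimeras to the pair, to the conclusion of NoExceptionalPrimes and to the field K of
QuinticFieldOfPair, then SectorComplement;
the bookkeeping item `Assembly` = cruxes → target is the same proof without the last step): given a
Booker pair,
QuinticFieldOfPair yields K with the splitting pattern, NoExceptionalPrimes yields temperedness
a.e., and NoChimeras — whose
hypotheses are these two conclusions verbatim — yields σ. The summit conjunct (A)
`AutomorphicToGalois` for these π (L-algebraic:
Maass eigenvalue ¼, infinity type (0,0)) then reads ρ_{π,ℓ,ι} = ι⁻¹∘σ (finite image, de Rham of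
Hodge–Tate weight 0, unramified
a.e., Satake–Frobenius matching as typed); local–global compatibility at the remaining places
(Deligne–Henniart) and
uniqueness (Chebotarev + Brauer–Nesbitt) are standard and deliberately not restated inside the
sector; they, π', and everything
outside Booker's class ((A) for every other (F, n, π), all of direction (B), the reciprocity data 𝓡)
are exactly the content of
`SectorComplement`, which is trivially implied by `Langlands` and is not this route's claim.

Rationale: WHY THIS LINE. Mechanism (card e8a7-quintic-fourier-support): E₈ ⊃ P = P_{α₅} (Bourbaki) has Levi of
type A₄+A₃ (dim 40), unipotent radical
graded (40,30,20,10,4) with 𝔲₁ = 4⊗∧²5 = Bhargava's space of quintic rings (generic stabiliser S₅,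
rational non-degenerate orbits ↔
étale quintic ℚ-algebras: WrightYukie1992, Bhargava2008 pp. 57–58, 63) and Richardson orbit the
distinguished orbit E₈(a₇) (dim 208,
component group S₅, Miller2012 pp. 4, 8: marking 00002000, the Borel residue there is the split
member of the packet); for a Booker
pair put σ_L = (π⊠π^τ)⊗Sym⁴π on the Levi (cuspidal by Ramakrishnan2000 Thm M, Kim2002,
KimShahidi2002, KimShahidi2002Cuspidality);
of the five Langlands–Shahidi representations r₁..r₅ = ∧²5⊗4, 5⊗∧²4, 5⊗4, ∧²5, 4 of (E₈, A₃×A₄)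
(Kim2008) only r₁ contains the
trivial representation of A₅, exactly once (support item A5PolePattern, checked numerically here),
so E(σ_L,s) has a unique simple
pole at the E₈(a₇) point and its residue R(π) is an L² automorphic form on E₈ attached to the pair —
the Eisenstein series is a
DETECTOR of icosahedrality; the conjecture EFS (exceptional Fourier support: WF(R(π)) = E₈(a₇)
globally, and locally the spherical
constituent at p supports the generic character ψ_x of U/[U,U] = V(ℚ_p) only when the quintic
ℚ_p-algebra K_x has Frobenius
c_p(λ_π(p)) — Okada2021, Lusztig1992, GanGurevichJiang2002 / GanGrossSavin2002 one rung down on G₂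
with cubic algebras and S₃)
makes the A₅ field a RATIONAL POINT x ∈ V(ℚ): this is X2. Imported areas: automorphic forms on
exceptional groups (Eisenstein
residues, unipotent Arthur packets), p-adic harmonic analysis (wavefront sets, generalized
Gelfand–Graev models), prehomogeneous
vector spaces / higher composition laws, and arithmetic equivalence of number fields (Perlis1977,
for X3). What it does that the 35
existing routes and the negatives index do not: it runs AUTOMORPHIC → GALOIS in the non-solvable
even sector with no cohomology, no
base change, no converse theorem and no patching (EvenIcosahedralCM, EvenArtinGL4Door,
BianchiArtinPoints, PSL2ArtinDoor,
AnalyticDescent, GaloisWeightedBE all go Galois → automorphic); the one refuted statement of the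
summit (stmt-Langlands-3797,
K3 Kuga–Satake Serre-type anchor) is unrelated and unused.

RANKED CRUXES. #0 BookerPairReciprocity (target) — for every Booker pair (π, π') on GL₂/ℚ (cuspidal;
not nearly equivalent; neither of dihedral type = no quadratic Satake self-twist; a.e. Satake
parameters {α,β} with αβ = 1 and α+β = a + bφ, resp. a + bφ^τ, a, b ∈ ℤ) there is an irreducible σ :
Γ_ℚ → GL₂(ℂ) (`FramedGaloisRep ℚ ℂ 2`) of icosahedral type (projective image ≃ A₅) with π = π(σ)
(Satake–Frobenius matching at almost every place, the definiens of `IsPiOfArtinRep`; all items typed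
over the Statement cone alone, see TYPING in the thesis). σ is then even and π a Maass form of
eigenvalue ¼; direction (A) for n = 2, F = ℚ, Booker's class, Artin form (local–global clauses at
the finitely many remaining places are not restated, convention of EvenIcosahedralCM /
EvenArtinGL4Door). (why it might fail: Wide open: no even icosahedral-type Maass pair is known to
carry a Galois representation (Booker2018 'unable to conclude'; Calegari2023 §12); as stated it also
asserts λ = ¼ and S = ∅ for the class — refutable only by a pair violating Booker's Chebotarev
statistics.) [Booker2018, Calegari2023, Brumley2003, Kim2004]
#2 QuinticFieldOfPair (crux) — every Booker pair (π, π') has a quintic number field K (finrank ℚ K =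
5) such that for all but finitely many p and Satake data with λ_π(p) = a + bφ: p𝓞_K is squarefree
and the multiset of norms of its prime factors is {p,p,p,p,p} if λ = ±2, {p²,p²,p} if λ = 0,
{p³,p,p} if λ = ±1, {p⁵} if λ ∈ {±φ, ±φ^τ} (card items K3 → K2 → K1: the field is the rational orbit
x ∈ ℚ⁴⊗∧²ℚ⁵ carrying a non-zero quintic Fourier coefficient of R(π) = Res_{s=1}
E_{E₈}((π⊠π^τ)⊗Sym⁴π, s), Wright–Yukie/Bhargava dictionary, EFS local matching at p ∉ S).
[difficulty: open-problem] (why it might fail: Its only road is EFS on E₈: Fourier support of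
E₈(a₇)-packet members may spread over all quintic types (Saito–Kurokawa pattern via periods), or
Achar–Sommers/Okada duality may send (E₈(a₇), 5-cycle) to a smaller orbit, killing every
non-degenerate coefficient at order-5 primes.) [GanGurevichJiang2002, GanGrossSavin2002, Miller2012,
Kim2008, Bhargava2008, WrightYukie1992, Okada2021, Lusztig1992, arXiv:2112.14354]
#3 NoChimeras (crux) — for a Booker pair (same four hypotheses) tempered at almost every place, ANY
quintic field K with the splitting pattern of QuinticFieldOfPair forces π = π(σ) for some
irreducible σ of icosahedral type (card K4 'no chimeras' plus the matching the S₅-label cannot see: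
Galois closure M of K has group A₅ by densities 1,15,20,24/60; Tate lift σ of M; ρ_{M,4} ↔ π⊠π^τ and
ρ_{M,5} ↔ Sym⁴π match from cycle types alone; the 5A/5B assignment of order-5 primes to λ = ±φ vs
±φ^τ and the sign ε(p) = λ_π(p)/tr σ⊗χ(Frob_p) are the content). Conjecture-true: reciprocity for π
gives K' with the same splitting types a.e., and Perlis1977 (arithmetically equivalent fields of
degree ≤ 6 are isomorphic) gives K ≅ K'. [deps: QuinticFieldOfPair, NoExceptionalPrimes]
[difficulty: L] (why it might fail: Cycle types fix only S₅-classes: the 5A/5B split of order-5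
primes against λ = ±φ/±φ^τ and the sign ε(p) twist exactly the genuine characters of 2.A₅ and are
invisible to L(π⊠π^τ), L(Sym⁴π); needs a mixed GL₂×GL₃ invariant or MartinRamakrishnan2016-type
rigidity.) [Perlis1977, Booker2018, Kim2004, MartinRamakrishnan2016, Ramakrishnan2000]
#4 NoExceptionalPrimes (crux) — every Booker pair (same four hypotheses) is tempered at all but
finitely many finite places (all Satake parameters of π and of π' of absolute value 1 for a.e. v);
equivalently Booker's exceptional set S of non-tempered primes is finite, hence (Booker2018 Thm
1(3e), via Ramakrishnan's s-icosahedral criterion) empty with π_∞ of Galois type. [difficulty: L]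
(why it might fail: Equivalent to finiteness of Booker's S, known only if Sym⁵π is automorphic; the
positivity/Landau method stops at #{p ∈ S, p ≤ X} ≪ X^{1-δ}; Selberg–Ramanujan for Maass forms is
open (best exponent 7/64, Kim–Sarnak appendix to Kim2002).) [Booker2018, Kim2002,
KimShahidi2002Cuspidality, arXiv:1712.06876]
#9 E8Alpha5Grading (support) — in the Bourbaki model of E₈ (roots ±e_i±e_j and ½(±1,…,±1) with an
even number of minus signs, doubled to be integral; α₅ = e₄ − e₃, fundamental coweight ϖ₅ =
e₄+e₅+e₆+e₇+4e₈) there are 240 roots, 32 of α₅-degree 0 (Levi A₄+A₃, dim 40 with the Cartan) and 40,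
30, 20, 10, 4 of α₅-degree 1, 2, 3, 4, 5 (so dim 𝔲 = 104, dim 𝔩 = dim 𝔲₁ = 40, Richardson orbit of
dimension 248 − 40 = 208 = dim E₈(a₇)); card item P1, checked numerically in this session.
[difficulty: provable-now] [Bourbaki2002LieGroups46, ConwaySloane1999, Miller2012]
#9 A5PolePattern (support) — with χ₄ = (fixed points on 5 letters) − 1 and χ₅ = Sym²χ₄ − χ₄ − 1 the
characters of the 4- and 5-dimensional irreducible representations of A₅ (written as ψ = 2χ₅ to stay
integral), the sums over A₅ give: χ₄, χ₅ irreducible (norms 60, 240/4), ⟨4,1⟩ = ⟨5⊗4,1⟩ = ⟨5⊗∧²4,1⟩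
= ⟨∧²5,1⟩ = 0 and ⟨∧²5⊗4,1⟩ = 1 (sum 480/8/60) — the pole pattern of L(s,σ_L,r_i), i = 1..5, for
(E₈, A₃×A₄) restricted to A₅ through (ρ₄, ρ₅): a unique simple pole, from r₁, at the E₈(a₇) point;
card item P1 / cheapest falsifier, checked numerically in this session. [difficulty: provable-now]
[Kim2008, Booker2018, GanGurevichJiang2002]
#9 SectorComplement (support; OUT-OF-SCOPE REMAINDER, never staffed from this route) —
BookerPairReciprocity → Langlands: the rest of the summit (inside the sector: π', local–global
compatibility at every finite place, irreducibility/uniqueness and the reciprocity data 𝓡; outside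
it: direction (A) for every other (F, n, π) and all of direction (B)); trivially implied by
`Langlands`; filed only so that the deciding theorem `closes : QuinticFieldOfPair → NoChimeras →
NoExceptionalPrimes → SectorComplement → Langlands` ends at the sub-problem Statement (D-0027 §2.1;
convention of CapacityClassicality.SectorToLanglands, DegenerateLimits.LanglandsOfTarget,
SiegelEisensteinFern.BeyondSiegelFern, QuadraticWindow.BeyondTheWindow,
TriangulineChamber.SliceToLanglands). Refuters/graders judge the route on the three cruxes, not on
this item. [difficulty: open-problem] [BuzzardGeeLMS2014, FontaineMazurGeometric1995, Booker2018]

TWO-LAYER PLAN. Foreseen glued splits, filed only when a crux closes or the definition requests land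
(k ≤ 3, depth 1):
QuinticFieldOfPair ⇐ ResidueAtE8a7 (K3: E(σ_L,s) on E₈ has a simple pole at s = 1 and no other in Re
s > 0, residue L² with local
components J_p(c_p)) → EFSGlobal (K2: some non-degenerate quintic Fourier coefficient of R(π) is
non-zero, WF = E₈(a₇)) → EFSLocal
(K1: J_p(c) supports ψ_x only if K_x ≅ K(c), canonical unramified wavefront {(E₈(a₇),[c])}) →
QuinticFieldOfPair (glue = Wright–Yukie
dictionary + 'an étale quintic algebra with a density-2/5 set of inert primes is a field'); filed
now as ONE informal crux
ExceptionalFourierSupport until the E₈ notions exist in Lean.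
NoChimeras ⇐ FieldRigidity (K unique up to isomorphism and Gal(M/ℚ) = A₅, ρ_{M,4}, ρ_{M,5}
automorphic = π⊠π^τ, Sym⁴π: the
Kim2004 frame run from the automorphic side) → SignAndFiveCycleMatching (ε and the 5A/5B assignment
are a Hecke character resp.
consistent) → NoChimeras.
NoExceptionalPrimes ⇐ (weak automorphy of Sym⁵π in Booker's sense) → NoExceptionalPrimes, or a
direct density bootstrap.

KILL CRITERIA. (i) EFS-local false one rung down: if in GanGurevichJiang2002 the spherical member of
a cubic unipotent packet of G₂ at a prime
INERT in the cubic field supports the generic (N, ψ_E)-coefficient of the wrong cubic algebra (or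
none), the E₈ analogue dies and with
it the only road to QuinticFieldOfPair — close `refuted:QuinticFieldOfPair` only if a Booker pair
with no quintic field is exhibited,
otherwise pivot the route to the FORWARD direction (odd icosahedral weight-one pairs, automorphic by
Khare–Wintenberger, as a
theorem-target constructing the quintic unipotent packets). (ii) A computation (Achar–Sommers
duality / arXiv:2112.14354 tables)
showing the canonical unramified wavefront of the spherical E₈(a₇)-parameter representation with
5-cycle Frobenius is a smaller
orbit: same effect. (iii) A Booker pair with infinitely many non-tempered primes refutes
NoExceptionalPrimes and the target as typed
(pivot: restate both off a density-zero set). (iv) Strong Artin + reciprocity for even icosahedral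
forms proved elsewhere
(EvenIcosahedralCM, EvenArtinGL4Door) moots NoChimeras but not the mechanism.

NOT DECOMPOSED YET. The three E₈ steps K1–K3 (no E₈ Eisenstein series, Fourier coefficients along
U_{α₅} or p-adic wavefront sets in Lean: definition
requests below; they are the layer-2 children of QuinticFieldOfPair); the normalisation of
intertwining operators for (E₈, A₃×A₄)
at s = 1 and whether it needs S = ∅ (child of K3); the 5A/5B and sign matching inside NoChimeras;
the archimedean component of
R(π); any use of the residue for a GIVEN even ρ (direction (B) is not claimed).

CHEAPEST FALSIFIER. (1) The pole pattern and the grading numerology — had r₂..r₅ contained the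
trivial A₅-representation or r₁ contained it twice, the
residue would sit at the wrong point/order: computed in this session (python: A₅ sums 0, 60, 240, 0,
0, 0, 480; E₈ grading 32/40/30/
20/10/4 of 240) — PASSES; filed as the provable-now supports A5PolePattern and E8Alpha5Grading. (2)
Next cheapest, a lookup a
refuter can do in an hour once acq-02393 (GanGurevichJiang2002 full text) is fulfilled: the local
cubic unipotent packet of G₂ at a
prime inert in E — does its spherical member support the generic (N, ψ_{E_p}) functional? If NOT,
EFS-local fails a fortiori on E₈.
(3) The canonical unramified wavefront set of the spherical Arthur-type representation of E₈(ℚ_p)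
with parameter (E₈(a₇), c), c a
5-cycle, from Okada2021 / arXiv:2112.14354 (finite computation with Achar–Sommers duality).

NUMBERS. E₈: |Φ| = 240, α₅-grading (40,30,20,10,4), dim 𝔩 = 40 = dim 𝔲₁, dim E₈(a₇) = 208, A(E₈(a₇))
= S₅ (Miller2012; Bourbaki2002LieGroups46
Plate VII). A₅: class sizes 1,15,20,12,12; χ₄ = (4,0,1,−1,−1), χ₅ = (5,1,−1,0,0); ⟨r₁,1⟩ = 1,
⟨r_k,1⟩ = 0 (k = 2..5). Booker2018 Thm 1: densities of {p : λ_π(p) = α} by norm αα^τ = 0, 1, 4, −1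
are 1/4, 1/6, 1/120, 1/10
(per value: 0 ↦ 15/60, ±1 ↦ 10/60 each, ±2 ↦ 1/120 each, ±φ^{(τ)} ↦ 6/60 each = A₅ class sizes 15,
20, 1, 12+12 over 60, halved by sign); #S(X) ≪ X^{1−δ}.
Cone: 38 → 17 unproved named facts in the import cone (the 17 are the Statement's own; 21 dropped
with the two imports).

DEFINITION REQUESTS. D1 `BhargavaQuinticSpace` (topic Literature/NumberTheory/QuinticRings or
Automorphic): V(R) = R⁴ ⊗ ∧²R⁵ with its GL₄×SL₅-action,
the discriminant/non-degeneracy, and the named fact (WrightYukie1992; Bhargava2008 Thm 1 / §5) that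
non-degenerate G(k)-orbits
correspond to étale quintic k-algebras with stabiliser Aut. D2 `E8QuinticEisensteinDatum` (topic
Literature/NumberTheory/
Automorphic): the Eisenstein series on split E₈ induced from a cuspidal representation of the Levi
of P_{α₅}, its Langlands–Shahidi
L-functions L(s,σ,r_i), i = 1..5 (Kim2008) and the residue at s = 1, as an interface with a separate
construction statement.
D3 `QuinticFourierCoefficient` / `CanonicalUnramifiedWavefront` (same topic): the ψ_x-Fourier
coefficient along U_{α₅} for
x ∈ V(ℚ) and the p-adic canonical unramified wavefront set (Okada2021). Cite facts wanted:
Booker2018 Thm 1 (as a named fact over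
`CuspidalAutomorphicRepData`), Perlis1977 Thm 1, Kim2008 (meromorphy and normalisation for (E₈,
A₃×A₄)). All filed after open
with `--for` the informal crux ExceptionalFourierSupport.

Novelty: Searches (2026-08-15, this planner): `lit galaxy search --star all` ×3 ("Fourier coefficients of
automorphic forms on E8": 0/0/0;
"Eisenstein series on E8": 0/0/0; "arithmetically equivalent": 20 rows, all noise); `lit search`
("Fourier coefficients Eisenstein
series E8 quintic", "… unipotent orbit wavefront set residual Eisenstein series") — local searchd
unavailable (rc 75) at 13:40,
13:55 and 14:20 UTC, logged; remote cascade by source: zbMATH "unipotent Arthur packet E8" (0),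
"Maass form icosahedral Galois
representation" (2: zbl:0703.11062 Henniart's Bourbaki report on Galois representations for Maass
forms over imaginary quadratic
fields — cohomological, other sector; doi:10.1007/s002220200223 Duke–Friedlander–Iwaniec
subconvexity — unrelated), "wave front set
residual Eisenstein series" (1: doi:10.1016/j.jnt.2020.11.001 Ginzburg–Soudry, classical groups),
"quintic algebra Fourier coefficient
exceptional group" (0), "arithmetically equivalent fields quintic" (1, noise); crossref "Fourier
coefficients Eisenstein series E8
quintic rings" (8 generic Eisenstein-coefficient hits, none exceptional: Karel 1974, Gao 2021,
Fleig–Gustafsson–Kleinschmidt–Persson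
book ch. 7); OpenAlex / S2 / arXiv API rate-limited (HTTP 429) this session; `lit read
arxiv:1712.06876` pp. 1–9 in full; grep of all 35 Theses of the sub for
E8/quintic/Bhargava/wavefront/Fourier
support/Booker pair (10 hits, all about non-normal quintic AI, none on exceptional groups). Searches
inherited from the card an  [refs: 10.1007/s002220200223, 10.1016/j.jnt.2020.11.001, 1712.06876, 1205.0426, doi:10.1007/s002220200223, doi:10.1016/j.jnt.2020.11.001, arxiv:1712.06876, Miller2012, GanGurevichJiang2002, GanGrossSavin2002, Bhargava2008, WrightYukie1992, Kim2008, Booker2018, Kim2004, Okada2021]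

Barriers (technique_class: exceptional-eisenstein-residue, arithmetic-wavefront): - technique_class: exceptional-eisenstein-residue, arithmetic-wavefront
- Literature.Barriers.Langlands.SolvableImageBarrier: evaded — nothing is base-changed and no Artin
representation is assumed automorphic; the A₅ field appears as a rational point of V(ℚ) = ℚ⁴⊗∧²ℚ⁵
indexing a non-zero Fourier coefficient, with H¹(ℚ_p, S₅) (quintic étale algebras), not a tower of
cyclic layers, carrying the local matching; the output image 2.A₅ is exactly what the barrier
forbids for towers.
- Literature.Barriers.Langlands.SolvableImageBarrierNarrow: the non-normal quintic layer the audit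
singles out is precisely the field K produced by QuinticFieldOfPair; no descent along it is
performed (NoChimeras matches π with σ over ℚ by rigidity, not by quintic descent) — the bet is that
rigidity (Perlis + mixed invariants) replaces Getz's conjectural trace identities.
- Literature.Barriers.Langlands.NonRegularWeightBarrier: evaded — no locally symmetric space
cohomology, eigenvariety or p-adic interpolation; π enters only through its L-functions and
Whittaker model (Langlands–Shahidi), available verbatim at infinitesimal character 0 as in
Kim–Shahidi's Sym³/Sym⁴.
- Literature.Barriers.Langlands.TwistedEndoscopySelfDual: not in this class — Eisenstein series and
residues are Langlands' spectral theory on E₈, no twisted trace formula comparison; π⊠π^τ and Sym⁴π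
are used as given cuspidal representations (theorems).
- Literature.Barriers.Langlands.ShimuraVarietyRealizationBarrier: not in this class —

Novelty grade: new-mechanism — ROUTE REVIEW (refuter rreview1 f80e030d, 2026-08-16; record: REVIEW_E8QuinticResidue.md on stmt-11143/4/5/6; W.lean rc0 rev 4). VERDICT KEEP OPEN: target+3 cruxes precise, rc0, grounded, stamped; no junk model (BJ 4.6 interface); not refuted (negatives only 3797; barriers: class outside all catalogu (refuter refuter-rreview1-Langlands-E8QuinticResidue-f80e030d-0, 2026-08-16T14:05:02Z; prior: doi:10.1007/s002220200210, doi:10.1215/00127094-8229798, HuangMagaardSavin1998, arXiv:1712.06876, KimShahidi2002, GRS-descent, Bhargava2008, WrightYukie1992, arXiv:2112.14354, arXiv:2107.10591)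

History (route lifecycle, newest last):
- 2026-08-15T16:44:37Z · rev 2: restated BookerPairReciprocity (stmt-Langlands-8666), QuinticFieldOfPair (stmt-Langlands-8667), NoChimeras (stmt-Langlands-8668), NoExceptionalPrimes (stmt-Langlands-8669) — cone route-repair (rrepair-f80e030d): imports := [] — Automorphic.StrongArtinGL2 and Automorphic.RamakrishnanTensorProductGL2 dropped; they (planner-rrepair-Langlands-E8QuinticResidue-f80e030d-0)
- 2026-08-16T16:41:49Z · AUTO-CRUX (backfill): SectorComplement — hypotheses of the deciding theorem that nothing in the route derives are cruxes (operator:999:1813213)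
- 2026-08-22T05:32:53Z · DORMANT — reconciler: no traction for 5.1 d (last activity item-evidence-added at 2026-08-17T02:32:43Z); parked, not closed — `ledger route dormant route-Langlands-E8Quin (operator:999:2917538)
- 2026-09-01T00:32:32Z · REACTIVATED (open) — reconciler: reactivated — activity item-proof-filed at 2026-08-31T23:21:31Z after parking at 2026-08-22T05:32:53Z (operator:999:3955588)

sub-problem: Langlands · status: open · opened planner-plancard-Langlands-Langlands-e8a7-qui-0fb46d3a-0 2026-08-15T13:26:53Z · rev 4 · ledger route-Langlands-E8QuinticResidue
GENERATED by the gate from the ledger (D-0016/17). Provers cite these decls: `theorem foo : Summit.Langlands.Langlands.Theses.E8QuinticResidue.<Decl> := …` in Summits/Langlands/Langlands/Theorems/<Name>.lean.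
-/

namespace Summit.Langlands.Langlands.Theses.E8QuinticResidue

open scoped BigOperators Topology Manifold Classical MeasureTheory ProbabilityTheory Matrix InnerProductSpace ComplexConjugate ContinuousMap
open Filter Set Function TopologicalSpace MeasureTheory

attribute [summit_statement] _root_.Langlands

-- earlier BookerPairReciprocity (stmt-Langlands-8666, replaced 2026-08-15T16:44:37Z -> stmt-Langlands-11143): retired by None — ∀ (hcpt : Literature.NumberTheory.Automorphic.isCompact_glFiniteIntegralLevel 2 ℚ) (π π' : Literature.NumberTheory.Automorphic.CuspidalAutomorphicRepData 2 ℚ hcpt), ¬ π.1.IsNearlyEquivalent π'.1 → ¬ Literature.NumberTheory.Automorphic.IsSatakeSelfTwist π.1 → ¬ Literature.Nu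
/-- item stmt-Langlands-11143 · target · rank 0 · open · by planner
why it might fail: Automorphic→Galois for weight-0 Maass forms is wide open: Booker2018 Thm 1 stops at statistics (3a)–(4), 'unable to conclude' a Galois rep without the Sym⁶ criterion; Sym^n known only for regular algebraic π (NewtonThorneIHES2021a); as typed, an exotic pair (S infinite by ¬(3e)) has no Artin σ.
sources: Booker2018, arXiv:1712.06876, Calegari2023, Brumley2003, Kim2004, NewtonThorneIHES2021a
[target] for every BOOKER PAIR (π, π') — π, π' cuspidal on GL₂/ℚ, not nearly equivalent, neither of
dihedral type (for no quadratic field K are the Satake parameters at a.e. K-inert place stable under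
α ↦ −α: the Hecke-character-free form of 'no self-twist', Booker2018 Thm 1), a.e. Satake parameters
{α,β}, {α',β'} with αβ = α'β' = 1, α+β = a + bφ, α'+β' = a + bφ^τ (a, b ∈ ℤ, φ = (1+√5)/2) — there
is an irreducible σ : Γ_ℚ → GL₂(ℂ) (`FramedGaloisRep ℚ ℂ 2`) of icosahedral type (projective image ≃
A₅: the definiens of `IsIcosahedralType`) with π = π(σ): at a.e. finite place v, π has a Satake
parameter α, σ is unramified at v and Frobenius at v has characteristic polynomial ∏_{a∈α}(X − a)
(the definiens of `IsPiOfArtinRep σ π.1`). Typed over the cone of Summits.Langlands.Statement alone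
(cone route-repair 2026-08-15). σ is then even and π a Maass form of eigenvalue ¼; direction (A) for
n = 2, F = ℚ, Booker's class, Artin form (local–global clauses at the finitely many remaining places
not restated, convention of EvenIcosahedralCM / EvenArtinGL4Door). [difficulty: open-problem] -/
@[route_item "route-Langlands-E8QuinticResidue"]
def BookerPairReciprocity : Prop :=
  ∀ (hcpt : Literature.NumberTheory.Automorphic.isCompact_glFiniteIntegralLevel 2 ℚ) (π π' : Literature.NumberTheory.Automorphic.CuspidalAutomorphicRepData 2 ℚ hcpt), ¬ π.1.IsNearlyEquivalent π'.1 → (∀ (K : Type) [Field K] [NumberField K], Module.finrank ℚ K = 2 → ¬ ∀ᶠ v : IsDedekindDomain.HeightOneSpectrum (NumberField.RingOfIntegers ℚ) in Filter.cofinite, (Ideal.span {((v.residueCard : ℕ) : NumberField.RingOfIntegers K)}).IsPrime → ∀ α : Multiset ℂ, π.1.HasSatakeParamAt v α → π.1.HasSatakeParamAt v (α.map fun a => -a)) → (∀ (K : Type) [Field K] [NumberField K], Module.finrank ℚ K = 2 → ¬ ∀ᶠ v : IsDedekindDomain.HeightOneSpectrum (NumberField.RingOfIntegers ℚ) in Filter.cofinite,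 (Ideal.span {((v.residueCard : ℕ) : NumberField.RingOfIntegers K)}).IsPrime → ∀ α : Multiset ℂ, π'.1.HasSatakeParamAt v α → π'.1.HasSatakeParamAt v (α.map fun a => -a)) → (∀ᶠ v : IsDedekindDomain.HeightOneSpectrum (NumberField.RingOfIntegers ℚ) in Filter.cofinite, ∃ α α' : Multiset ℂ, π.1.HasSatakeParamAt v α ∧ π'.1.HasSatakeParamAt v α' ∧ α.prod = 1 ∧ α'.prod = 1 ∧ ∃ a b : ℤ, α.sum = (a : ℂ) + (b : ℂ) * ((1 + (Real.sqrt 5 : ℂ)) / 2) ∧ α'.sum = (a : ℂ) + (b : ℂ) * ((1 - (Real.sqrt 5 : ℂ)) / 2)) → ∃ σ : Literature.NumberTheory.GaloisRepresentations.FramedGaloisRep ℚ ℂ 2, σ.toGaloisRep.IsIrreducible ∧ Nonempty ((Matrix.ProjGenLinGroup.mk.comp σ.toMonoidHom).range ≃* alternatingGroup (Fin 5)) ∧ ∀ᶠ v : IsDedekindDomain.HeightOneSpectrum (NumberField.RingOfIntegers ℚ) in Filter.cofinite, ∃ α : Multiset ℂ, π.1.HasSatakeParamAt v α ∧ σ.IsUnramifiedAt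 v ∧ σ.HasFrobCharpolyAt v (Literature.NumberTheory.Automorphic.satakePolynomial α)

-- earlier QuinticFieldOfPair (stmt-Langlands-8667, replaced 2026-08-15T16:44:37Z -> stmt-Langlands-11144): retired by None — ∀ (hcpt : Literature.NumberTheory.Automorphic.isCompact_glFiniteIntegralLevel 2 ℚ) (π π' : Literature.NumberTheory.Automorphic.CuspidalAutomorphicRepData 2 ℚ hcpt), ¬ π.1.IsNearlyEquivalent π'.1 → ¬ Literature.NumberTheory.Automorphic.IsSatakeSelfTwist π.1 → ¬ Literature.Numbe
/-- item stmt-Langlands-11144 · crux · rank 2 · open · by planner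
why it might fail: Reciprocity-strength: nothing extracts a number field from a Maass pair (Booker2018 §1); its one road, E₈(a₇) Fourier support, is conjectural in 3 steps one rung above G₂ (GanGurevichJiang2002) and may smear over several quintic types; arXiv:2112.14354 covers real Satake parameters, not 5-cycles.
sources: Booker2018, arXiv:1712.06876, GanGurevichJiang2002, GanGrossSavin2002, Miller2012, Kim2008
[crux] every Booker pair (π, π') — π, π' cuspidal on GL₂/ℚ, not nearly equivalent, neither of
dihedral type (for no quadratic field K are the Satake parameters at a.e. K-inert place stable under
α ↦ −α: the Hecke-character-free form of 'no self-twist', Booker2018 Thm 1), a.e. Satake parameters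
{α,β}, {α',β'} with αβ = α'β' = 1, α+β = a + bφ, α'+β' = a + bφ^τ (a, b ∈ ℤ, φ = (1+√5)/2) — has a
quintic number field K (finrank ℚ K = 5) such that for all but finitely many places v (p = N v) and
Satake data with λ_π(p) = a + bφ: p𝓞_K is squarefree and the multiset of norms of its prime factors
is {p,p,p,p,p} if λ = ±2, {p²,p²,p} if λ = 0, {p³,p,p} if λ = ±1, {p⁵} if λ ∈ {±φ, ±φ^τ} (card items
K3 → K2 → K1: the field is the rational orbit x ∈ ℚ⁴⊗∧²ℚ⁵ carrying a non-zero quintic Fourier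
coefficient of R(π) = Res_{s=1} E_{E₈}((π⊠π^τ)⊗Sym⁴π, s); Wright–Yukie/Bhargava dictionary; EFS
local matching at p ∉ S). Typed over the cone of Summits.Langlands.Statement alone (cone
route-repair 2026-08-15). [difficulty: open-problem] -/
@[route_item "route-Langlands-E8QuinticResidue", crux]
def QuinticFieldOfPair : Prop :=
  ∀ (hcpt : Literature.NumberTheory.Automorphic.isCompact_glFiniteIntegralLevel 2 ℚ) (π π' : Literature.NumberTheory.Automorphic.CuspidalAutomorphicRepData 2 ℚ hcpt), ¬ π.1.IsNearlyEquivalent π'.1 → (∀ (K : Type) [Field K] [NumberField K], Module.finrank ℚ K = 2 → ¬ ∀ᶠ v : IsDedekindDomain.HeightOneSpectrum (NumberField.RingOfIntegers ℚ) in Filter.cofinite, (Ideal.span {((v.residueCard : ℕ) : NumberField.RingOfIntegers K)}).IsPrime → ∀ α : Multiset ℂ, π.1.HasSatakeParamAt v α → π.1.HasSatakeParamAt v (α.map fun a => -a)) → (∀ (K : Type) [Field K] [NumberField K], Module.finrank ℚ K = 2 → ¬ ∀ᶠ v : IsDedekindDomain.HeightOneSpectrum (NumberField.RingOfIntegers ℚ)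 in Filter.cofinite, (Ideal.span {((v.residueCard : ℕ) : NumberField.RingOfIntegers K)}).IsPrime → ∀ α : Multiset ℂ, π'.1.HasSatakeParamAt v α → π'.1.HasSatakeParamAt v (α.map fun a => -a)) → (∀ᶠ v : IsDedekindDomain.HeightOneSpectrum (NumberField.RingOfIntegers ℚ) in Filter.cofinite, ∃ α α' : Multiset ℂ, π.1.HasSatakeParamAt v α ∧ π'.1.HasSatakeParamAt v α' ∧ α.prod = 1 ∧ α'.prod = 1 ∧ ∃ a b : ℤ, α.sum = (a : ℂ) + (b : ℂ) * ((1 + (Real.sqrt 5 : ℂ)) / 2) ∧ α'.sum = (a : ℂ) + (b : ℂ) * ((1 - (Real.sqrt 5 : ℂ)) / 2)) → ∃ (K : Type) (_ : Field K) (_ : NumberField K), Module.finrank ℚ K = 5 ∧ ∀ᶠ v : IsDedekindDomain.HeightOneSpectrum (NumberField.RingOfIntegers ℚ) in Filter.cofinite, ∀ (α α' : Multiset ℂ) (a b : ℤ), π.1.HasSatakeParamAt v α → π'.1.HasSatakeParamAt v α' → α.sum = (a : ℂ) + (b : ℂ) * ((1 + (Real.sqrt 5 : ℂ)) / 2) →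 α'.sum = (a : ℂ) + (b : ℂ) * ((1 - (Real.sqrt 5 : ℂ)) / 2) → ∃ F : Multiset ℕ, (UniqueFactorizationMonoid.normalizedFactors (Ideal.span {((v.residueCard : ℕ) : NumberField.RingOfIntegers K)})).Nodup ∧ (UniqueFactorizationMonoid.normalizedFactors (Ideal.span {((v.residueCard : ℕ) : NumberField.RingOfIntegers K)})).map (fun P => Ideal.absNorm P) = F ∧ (b = 0 → (a = 2 ∨ a = -2) → F = Multiset.replicate 5 v.residueCard) ∧ (b = 0 → a = 0 → F = {v.residueCard ^ 2, v.residueCard ^ 2, v.residueCard}) ∧ (b = 0 → (a = 1 ∨ a = -1) → F = {v.residueCard ^ 3, v.residueCard, v.residueCard}) ∧ (((a = 0 ∧ (b = 1 ∨ b = -1)) ∨ (a = 1 ∧ b = -1) ∨ (a = -1 ∧ b = 1)) → F = {v.residueCard ^ 5})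

-- earlier NoChimeras (stmt-Langlands-8668, replaced 2026-08-15T16:44:37Z -> stmt-Langlands-11145): retired by None — ∀ (hcpt : Literature.NumberTheory.Automorphic.isCompact_glFiniteIntegralLevel 2 ℚ) (π π' : Literature.NumberTheory.Automorphic.CuspidalAutomorphicRepData 2 ℚ hcpt), ¬ π.1.IsNearlyEquivalent π'.1 → ¬ Literature.NumberTheory.Automorphic.IsSatakeSelfTwist π.1 → ¬ Literature.NumberTheory.
/-- item stmt-Langlands-11145 · crux · rank 3 · open · by planner
why it might fail: σ must be an SL₂(ℂ)-lift (det = αβ = 1 a.e.) of the A₅-closure M of K: needs M totally real and Serre's obstruction w₂(Tr x²) = 0 (doi:10.1007/bf02566371), invisible in splitting data; the sign ε(p) and 5A/5B matching are unseen by π⊠π′, Sym^{≤4}π; MartinRamakrishnan2016 needs L-factor agreement.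
sources: Perlis1977, Literature.NumberTheory.NumberFields.Perlis1977_thm3.algEquiv_of_splittingNorms, Booker2018, Kim2004, MartinRamakrishnan2016, arXiv:1502.04175
[crux] for a Booker pair (π, π') — π, π' cuspidal on GL₂/ℚ, not nearly equivalent, neither of
dihedral type (for no quadratic field K are the Satake parameters at a.e. K-inert place stable under
α ↦ −α: the Hecke-character-free form of 'no self-twist', Booker2018 Thm 1), a.e. Satake parameters
{α,β}, {α',β'} with αβ = α'β' = 1, α+β = a + bφ, α'+β' = a + bφ^τ (a, b ∈ ℤ, φ = (1+√5)/2) —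
tempered at a.e. place (all Satake parameters of π, π' of absolute value 1), ANY quintic field K
with the splitting pattern of QuinticFieldOfPair forces π = π(σ) for an irreducible σ : Γ_ℚ → GL₂(ℂ)
(`FramedGaloisRep ℚ ℂ 2`) of icosahedral type (projective image ≃ A₅), Satake–Frobenius matching
a.e. (definiens of `IsPiOfArtinRep`). Card K4: Gal(M/ℚ) = A₅ (M = Galois closure of K) by densities
1,15,20,24/60; Tate lift σ; ρ_{M,4} ↔ π⊠π^τ, ρ_{M,5} ↔ Sym⁴π by cycle types; the 5A/5B assignment at
order-5 primes and the sign ε(p) are the real work. Conjecture-true via Perlis1977 (degree ≤ 6: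
arithmetically equivalent ⇒ isomorphic). Typed over the cone of Summits.Langlands.Statement alone
(cone route-repair 2026-08-15). [deps: QuinticFieldOfPair, NoExceptionalPrimes] [difficulty: L] -/
@[route_item "route-Langlands-E8QuinticResidue", crux]
def NoChimeras : Prop :=
  ∀ (hcpt : Literature.NumberTheory.Automorphic.isCompact_glFiniteIntegralLevel 2 ℚ) (π π' : Literature.NumberTheory.Automorphic.CuspidalAutomorphicRepData 2 ℚ hcpt), ¬ π.1.IsNearlyEquivalent π'.1 → (∀ (K : Type) [Field K] [NumberField K], Module.finrank ℚ K = 2 → ¬ ∀ᶠ v : IsDedekindDomain.HeightOneSpectrum (NumberField.RingOfIntegers ℚ) in Filter.cofinite, (Ideal.span {((v.residueCard : ℕ) : NumberField.RingOfIntegers K)}).IsPrime → ∀ α : Multiset ℂ, π.1.HasSatakeParamAt v α → π.1.HasSatakeParamAt v (α.map fun a => -a)) → (∀ (K : Type) [Field K] [NumberField K], Module.finrank ℚ K = 2 → ¬ ∀ᶠ v : IsDedekindDomain.HeightOneSpectrum (NumberField.RingOfIntegers ℚ) in Filter.cofinite, (Ideal.span {((v.residueCard : ℕ) : NumberField.RingOfIntegers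 K)}).IsPrime → ∀ α : Multiset ℂ, π'.1.HasSatakeParamAt v α → π'.1.HasSatakeParamAt v (α.map fun a => -a)) → (∀ᶠ v : IsDedekindDomain.HeightOneSpectrum (NumberField.RingOfIntegers ℚ) in Filter.cofinite, ∃ α α' : Multiset ℂ, π.1.HasSatakeParamAt v α ∧ π'.1.HasSatakeParamAt v α' ∧ α.prod = 1 ∧ α'.prod = 1 ∧ ∃ a b : ℤ, α.sum = (a : ℂ) + (b : ℂ) * ((1 + (Real.sqrt 5 : ℂ)) / 2) ∧ α'.sum = (a : ℂ) + (b : ℂ) * ((1 - (Real.sqrt 5 : ℂ)) / 2)) → (∀ᶠ v : IsDedekindDomain.HeightOneSpectrum (NumberField.RingOfIntegers ℚ) in Filter.cofinite, (∀ α : Multiset ℂ, π.1.HasSatakeParamAt v α → ∀ a ∈ α, ‖a‖ = 1) ∧ (∀ α' : Multiset ℂ, π'.1.HasSatakeParamAt v α' → ∀ a ∈ α', ‖a‖ = 1)) → ∀ (K : Type) [Field K] [NumberField K], Module.finrank ℚ K = 5 → (∀ᶠ v : IsDedekindDomain.HeightOneSpectrum (NumberField.RingOfIntegers ℚ) in Filter.cofinite,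 ∀ (α α' : Multiset ℂ) (a b : ℤ), π.1.HasSatakeParamAt v α → π'.1.HasSatakeParamAt v α' → α.sum = (a : ℂ) + (b : ℂ) * ((1 + (Real.sqrt 5 : ℂ)) / 2) → α'.sum = (a : ℂ) + (b : ℂ) * ((1 - (Real.sqrt 5 : ℂ)) / 2) → ∃ F : Multiset ℕ, (UniqueFactorizationMonoid.normalizedFactors (Ideal.span {((v.residueCard : ℕ) : NumberField.RingOfIntegers K)})).Nodup ∧ (UniqueFactorizationMonoid.normalizedFactors (Ideal.span {((v.residueCard : ℕ) : NumberField.RingOfIntegers K)})).map (fun P => Ideal.absNorm P) = F ∧ (b = 0 → (a = 2 ∨ a = -2) → F = Multiset.replicate 5 v.residueCard) ∧ (b = 0 → a = 0 → F = {v.residueCard ^ 2, v.residueCard ^ 2, v.residueCard}) ∧ (b = 0 → (a = 1 ∨ a = -1) → F = {v.residueCard ^ 3, v.residueCard, v.residueCard}) ∧ (((a = 0 ∧ (b = 1 ∨ b = -1)) ∨ (a = 1 ∧ b = -1) ∨ (a = -1 ∧ b = 1)) → F = {v.residueCard ^ 5})) → ∃ σ : Literature.NumberTheory.GaloisRepresentations.FramedGaloisRep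 ℚ ℂ 2, σ.toGaloisRep.IsIrreducible ∧ Nonempty ((Matrix.ProjGenLinGroup.mk.comp σ.toMonoidHom).range ≃* alternatingGroup (Fin 5)) ∧ ∀ᶠ v : IsDedekindDomain.HeightOneSpectrum (NumberField.RingOfIntegers ℚ) in Filter.cofinite, ∃ α : Multiset ℂ, π.1.HasSatakeParamAt v α ∧ σ.IsUnramifiedAt v ∧ σ.HasFrobCharpolyAt v (Literature.NumberTheory.Automorphic.satakePolynomial α)

-- earlier NoExceptionalPrimes (stmt-Langlands-8669, replaced 2026-08-15T16:44:37Z -> stmt-Langlands-11146): retired by None — ∀ (hcpt : Literature.NumberTheory.Automorphic.isCompact_glFiniteIntegralLevel 2 ℚ) (π π' : Literature.NumberTheory.Automorphic.CuspidalAutomorphicRepData 2 ℚ hcpt), ¬ π.1.IsNearlyEquivalent π'.1 → ¬ Literature.NumberTheory.Automorphic.IsSatakeSelfTwist π.1 → ¬ Literature.Numb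
/-- item stmt-Langlands-11146 · crux · rank 4 · open · by planner
why it might fail: = finiteness of Booker's non-tempered set S (then S = ∅ by Thm 1(3e)); proved input: #S(X) ≪ X^{1−δ}: needs Sym⁵π automorphic (regular algebraic only, NewtonThorneIHES2021a) or Ramanujan for Maass forms (best 7/64, Kim–Sarnak in Kim2002); FALSE for an exotic pair (π_∞ non-Galois ⇒ S infinite).
sources: Booker2018, arXiv:1712.06876, Kim2002, KimShahidi2002, KimShahidi2002Cuspidality, NewtonThorneIHES2021a
[crux] every Booker pair (π, π') — π, π' cuspidal on GL₂/ℚ, not nearly equivalent, neither of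
dihedral type (for no quadratic field K are the Satake parameters at a.e. K-inert place stable under
α ↦ −α: the Hecke-character-free form of 'no self-twist', Booker2018 Thm 1), a.e. Satake parameters
{α,β}, {α',β'} with αβ = α'β' = 1, α+β = a + bφ, α'+β' = a + bφ^τ (a, b ∈ ℤ, φ = (1+√5)/2) — is
tempered at all but finitely many finite places (all Satake parameters of π and of π' of absolute
value 1 for a.e. v); equivalently Booker's exceptional set S of non-tempered primes is finite, hence
(Booker2018 Thm 1(3e), via Ramakrishnan's s-icosahedral criterion) empty with π_∞ of Galois type.
Typed over the cone of Summits.Langlands.Statement alone (cone route-repair 2026-08-15).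
[difficulty: L] -/
@[route_item "route-Langlands-E8QuinticResidue", crux]
def NoExceptionalPrimes : Prop :=
  ∀ (hcpt : Literature.NumberTheory.Automorphic.isCompact_glFiniteIntegralLevel 2 ℚ) (π π' : Literature.NumberTheory.Automorphic.CuspidalAutomorphicRepData 2 ℚ hcpt), ¬ π.1.IsNearlyEquivalent π'.1 → (∀ (K : Type) [Field K] [NumberField K], Module.finrank ℚ K = 2 → ¬ ∀ᶠ v : IsDedekindDomain.HeightOneSpectrum (NumberField.RingOfIntegers ℚ) in Filter.cofinite, (Ideal.span {((v.residueCard : ℕ) : NumberField.RingOfIntegers K)}).IsPrime → ∀ α : Multiset ℂ, π.1.HasSatakeParamAt v α → π.1.HasSatakeParamAt v (α.map fun a => -a)) → (∀ (K : Type) [Field K] [NumberField K], Module.finrank ℚ K = 2 → ¬ ∀ᶠ v : IsDedekindDomain.HeightOneSpectrum (NumberField.RingOfIntegers ℚ) in Filter.cofinite, (Ideal.span {((v.residueCard : ℕ) : NumberField.RingOfIntegers K)}).IsPrime → ∀ α : Multiset ℂ, π'.1.HasSatakeParamAt v α → π'.1.HasSatakeParamAt v (α.map fun a => -a)) → (∀ᶠ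 v : IsDedekindDomain.HeightOneSpectrum (NumberField.RingOfIntegers ℚ) in Filter.cofinite, ∃ α α' : Multiset ℂ, π.1.HasSatakeParamAt v α ∧ π'.1.HasSatakeParamAt v α' ∧ α.prod = 1 ∧ α'.prod = 1 ∧ ∃ a b : ℤ, α.sum = (a : ℂ) + (b : ℂ) * ((1 + (Real.sqrt 5 : ℂ)) / 2) ∧ α'.sum = (a : ℂ) + (b : ℂ) * ((1 - (Real.sqrt 5 : ℂ)) / 2)) → ∀ᶠ v : IsDedekindDomain.HeightOneSpectrum (NumberField.RingOfIntegers ℚ) in Filter.cofinite, (∀ α : Multiset ℂ, π.1.HasSatakeParamAt v α → ∀ a ∈ α, ‖a‖ = 1) ∧ (∀ α' : Multiset ℂ, π'.1.HasSatakeParamAt v α' → ∀ a ∈ α', ‖a‖ = 1)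

/-- item stmt-Langlands-10277 · crux (kind.auto-crux: conjecture-grade) · rank 9 · open · by planner
why it might fail: auto-crux — summit-strength (notes:refuter-refute-pool-g41-26): the deciding theorem assumes it and nothing in the route derives it, so it is a bet, not glue
sources: BuzzardGeeLMS2014, Booker2018
[support] OUT-OF-SCOPE REMAINDER = the rest of the summit: `BookerPairReciprocity → Langlands`. NOT
attacked by this route and not expected to close before the summit itself; filed only so that the
deciding theorem `closes : QuinticFieldOfPair → NoExceptionalPrimes → NoChimeras → SectorComplement
→ _root_.Langlands` honestly concludes the summit constant (D-0027 §2.1; same convention as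
GaloisWeightedBE.SectorComplement and CapacityClassicality.SectorToLanglands: the summit shape `∀ F
∃ 𝓡 ∀ n, (A) ∧ (B)` cannot follow from one sector), while the route's real target stays the sector
statement BookerPairReciprocity (direction (A), n = 2, F = ℚ, Booker's even icosahedral class, Artin
form `IsPiOfArtinRep`). It contains everything this thesis does not claim: direction (B), every (n,
F) ≠ (2, ℚ), every non-Booker π, local–global compatibility at every finite place and the
reciprocity data 𝓡 even inside the sector. Trivially implied by `Langlands`. Refuters/graders: judge
the route on QuinticFieldOfPair / NoChimeras / NoExceptionalPrimes, not on this item; never staffed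
from this route. [difficulty: open-problem] [sources: BuzzardGeeLMS2014, Booker2018] -/
@[route_item "route-Langlands-E8QuinticResidue", crux]
def SectorComplement : Prop :=
  BookerPairReciprocity → _root_.Langlands

-- item stmt-Langlands-8774 · support · rank 5 · open · by planner — informal only, no Lean statement yet:
--   [crux] EXCEPTIONAL FOURIER SUPPORT (card e8a7-quintic-fourier-support K3+K2+K1; the intended proof
--   of QuinticFieldOfPair and its foreseen glued split once definitions D1-D3 land; untyped: Lean has no
--   split E8, no Eisenstein series for (E8, P_alpha5), no Fourier coefficients along U_alpha5, no p-adic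
--   wavefront sets). For a Booker pair (pi, pi') put sigma_L := (pi x pi^tau) (x) Sym^4 pi on the Levi
--   GL4 x SL5 of the parabolic P = P_alpha5 (Bourbaki) of split E8 over Q (cuspidal on GL4 and GL5:
--   Ramakrishnan2000 Thm M, Kim2002, KimShahidi2002Cuspidality). (K3, RESIDUE) The Langlands-Shahidi
--   Eisenst

/-- item stmt-Langlands-8670 · support · rank 9 · closed · proved by Summit.Langlands.Langlands.Theorems.E8QuinticResidueE8Alpha5Grading.e8Alpha5Grading (prover) · by planner
sources: Bourbaki2002LieGroups46, ConwaySloane1999, Miller2012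
[support] in the Bourbaki model of E₈ (roots ±e_i±e_j and ½(±1,…,±1) with an even number of minus
signs, doubled to be integral; α₅ = e₄ − e₃, fundamental coweight ϖ₅ = e₄+e₅+e₆+e₇+4e₈) there are
240 roots, 32 of α₅-degree 0 (Levi A₄+A₃, dim 40 with the Cartan) and 40, 30, 20, 10, 4 of α₅-degree
1, 2, 3, 4, 5 (so dim 𝔲 = 104, dim 𝔩 = dim 𝔲₁ = 40, Richardson orbit of dimension 248 − 40 = 208 =
dim E₈(a₇)); card item P1, checked numerically in this session. [difficulty: provable-now] -/
@[route_item "route-Langlands-E8QuinticResidue"]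
def E8Alpha5Grading : Prop :=
  ∀ Φ : Finset (Fin 8 → ℤ), Φ = ((Fintype.piFinset fun _ : Fin 8 => ({-2, 0, 2} : Finset ℤ)).filter fun b => ∑ i, |b i| = 4) ∪ ((Fintype.piFinset fun _ : Fin 8 => ({-1, 1} : Finset ℤ)).filter fun b => ∏ i, b i = 1) → Φ.card = 240 ∧ (Φ.filter fun b => b 3 + b 4 + b 5 + b 6 + 4 * b 7 = 0).card = 32 ∧ (Φ.filter fun b => b 3 + b 4 + b 5 + b 6 + 4 * b 7 = 2).card = 40 ∧ (Φ.filter fun b => b 3 + b 4 + b 5 + b 6 + 4 * b 7 = 4).card = 30 ∧ (Φ.filter fun b => b 3 + b 4 + b 5 + b 6 + 4 * b 7 = 6).card = 20 ∧ (Φ.filter fun b => b 3 + b 4 + b 5 + b 6 + 4 * b 7 = 8).card = 10 ∧ (Φ.filter fun b => b 3 + b 4 + b 5 + b 6 + 4 * b 7 = 10).card = 4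

-- `E8Alpha5Grading` holds: proved by `Summit.Langlands.Langlands.Theorems.E8QuinticResidueE8Alpha5Grading.e8Alpha5Grading` (its module imports this route file, so no `_holds` link can be stated here).

/-- item stmt-Langlands-8671 · support · rank 9 · closed · proved by Summit.Langlands.Langlands.Theorems.E8QuinticResidueA5PolePattern.a5PolePattern (prover) · by planner
sources: Kim2008, Booker2018, GanGurevichJiang2002
[support] with χ₄ = (fixed points on 5 letters) − 1 and χ₅ = Sym²χ₄ − χ₄ − 1 the characters of the
4- and 5-dimensional irreducible representations of A₅ (written as ψ = 2χ₅ to stay integral), the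
sums over A₅ give: χ₄, χ₅ irreducible (norms 60, 240/4), ⟨4,1⟩ = ⟨5⊗4,1⟩ = ⟨5⊗∧²4,1⟩ = ⟨∧²5,1⟩ = 0
and ⟨∧²5⊗4,1⟩ = 1 (sum 480/8/60) — the pole pattern of L(s,σ_L,r_i), i = 1..5, for (E₈, A₃×A₄)
restricted to A₅ through (ρ₄, ρ₅): a unique simple pole, from r₁, at the E₈(a₇) point; card item P1
/ cheapest falsifier, checked numerically in this session. [difficulty: provable-now] -/
@[route_item "route-Langlands-E8QuinticResidue"]
def A5PolePattern : Prop :=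
  ∀ χ ψ : alternatingGroup (Fin 5) → ℤ, (∀ g, χ g = ((Finset.univ.filter fun i : Fin 5 => (g : Equiv.Perm (Fin 5)) i = i).card : ℤ) - 1) → (∀ g, ψ g = χ g ^ 2 + χ (g ^ 2) - 2 * χ g - 2) → (∑ g, χ g = 0) ∧ (∑ g, χ g ^ 2 = 60) ∧ (∑ g, ψ g ^ 2 = 240) ∧ (∑ g, ψ g * χ g = 0) ∧ (∑ g, ψ g * (χ g ^ 2 - χ (g ^ 2)) = 0) ∧ (∑ g, (ψ g ^ 2 - 2 * ψ (g ^ 2)) = 0) ∧ (∑ g, (ψ g ^ 2 - 2 * ψ (g ^ 2)) * χ g = 480)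

-- `A5PolePattern` holds: proved by `Summit.Langlands.Langlands.Theorems.E8QuinticResidueA5PolePattern.a5PolePattern` (its module imports this route file, so no `_holds` link can be stated here).

/-- item stmt-Langlands-8672 · assembly · rank 1 · open · by planner
sources: Booker2018, Perlis1977
[assembly] QuinticFieldOfPair → NoExceptionalPrimes → NoChimeras → BookerPairReciprocity. -/
@[route_item "route-Langlands-E8QuinticResidue"]
def Assembly : Prop :=
  QuinticFieldOfPair → NoExceptionalPrimes → NoChimeras → BookerPairReciprocity

/-! D-0027 §2.1 — DECIDING THEOREM (planner-authored via `route open/edit --closes-file`; by planner-rrepair-Langlands-E8QuinticResidue-f80e030d-0 2026-08-15T16:44:37Z):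
its hypotheses are this route's items and its conclusion the sub-problem Statement (glue_lint), and it elaborates with this file. -/

@[closes "route-Langlands-E8QuinticResidue"] theorem closes (h2 : QuinticFieldOfPair) (h3 : NoChimeras) (h4 : NoExceptionalPrimes)
    (hC : SectorComplement) : _root_.Langlands := by
  refine hC ?_
  intro hcpt π π' hne hst hst' hbook
  obtain ⟨K, _instF, _instN, hrank, hpat⟩ := h2 hcpt π π' hne hst hst' hbook
  exact h3 hcpt π π' hne hst hst' hbook (h4 hcpt π π' hne hst hst' hbook) K hrank hpat

end Summit.Langlands.Langlands.Theses.E8QuinticResidue
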